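import Summits.QuantumFields.YangMills.Theorems.FluctuationComparisonRegPrIntLS2BetaChartReadIterFromSup
import HarnessLib

/-!
# S2β · (REG-UP)′ bridge (O2-b2)′ — «THE SEGMENT SUP ROW, TARGET-INDEXED»: ✓p840392's row `‖D_{k₀→k₀+n} X B‖ ≤ Λ·Lⁿ·‖X‖` re-read with the target level as an INDEPENDENT index `k`
# (`k₀ + n = k`), through the in-tower reindexing `bondShift : PBond (F.P K) k ≃ PBond (F.P K) (k₀+n)` — the `hseg` inhabitant of px13 g29's (hNL) v2 `…S2BetaSecondOrderTowerSup`
# (`Dseg i k : (PBond P i → M) → (PBond P k → M)`; px13 02:52:55Z «(ii)-SEQUEL»)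

Cell `ym3-torus` (YM ladder rung R3 = continuum `SU(2)` Yang–Mills on the three-torus at fixed lattice data — a RUNG: NOT d = 4, NOT infinite volume, NOT a mass gap,
NOT Clay).  Width seat «width 12» `ym3-torus-px12` (gen 27); crux `stmt-QuantumFields-20520`, LINE g18-1 S2β, node (REG-UP)′.  `--kind proof --supports stmt-QuantumFields-20520 --as helper`,
count-neutral, DEFINITION-FREE (0 `def`, 0 `instance`, 0 `notation`, 0 `sorry`, default heartbeats).  `SU(N)`, `T3Family` members.

WHAT IS PROVED (sorry-free).  With `σ := bondShift (F.sitesPerDir_eq …) : PBond (F.P K) k ≃ PBond (F.P K) (k₀ + n)` (same tower, `k₀ + n = k`) and the TARGET-INDEXED segment map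
`Ψ^{W}_{k₀→k} A c := Ψ^{W}_{k₀,n} A (σ c)` (= `Λ(Ū_{k₀}^{n}(Θ(A)·W)(σc)·Ū_{k₀}^{n}(W)(σc)⁻¹)`):
★`fderiv_chartReadFromAt_eq` (`fderiv ℝ Ψ^{W}_{k₀→k} 0 = R_σ ∘L fderiv ℝ Ψ^{W}_{k₀,n} 0`, `R_σ Y := Y ∘ σ`) and ★★★**`norm_fderiv_chartReadFromAt_apply_le_exp`** —
**`‖↑((fderiv ℝ Ψ^{W}_{k₀→k} 0 X) B)‖ ≤ (1 + 4(d+2))·exp((d+2)(422 + 1616(d+2))·Σ_{i<n} α_i)·L^n·‖X‖`** for `B : PBond (F.P K) k`, same guards as ✓p840392; and its SUP FORM ★★★`norm_fderiv_chartReadFromAt_apply_le_of_sup` — `(∀ b, ‖↑(X b)‖ ≤ s) → ‖↑(D_{k₀→k} X B)‖ ≤ Λ·L^{k−k₀}·s`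
(verbatim px13 g29's `hseg (Y) (s) : (∀ b, ‖Y b‖ ≤ s) → ∀ c, ‖Dseg i k Y c‖ ≤ Λ * L ^ (k - i) * s`).

HONEST SCOPE.  A reindexing corollary (chain rule with a pre-composition CLM) of ✓p840392; nothing of Bałaban's renormalisation-group analysis proved; (hNL)∕(O2-b3)∕`hDcov`∕(REG-UP)′∕GAP♯∘ (`stub_uniformFibreGapOrbit`,
registry 3732b7df UNTOUCHED, 0∕5), the five registered stubs, S2β, crux 20520, 19936, 19200, `YM3TorusSU2` — NOT proved; rung R3 — NOT d = 4, NOT infinite volume, NOT a mass gap, NOT Clay;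
the Yang–Mills mass gap is NOT proved.
-/

set_option autoImplicit false

noncomputable section

open scoped Matrix.Norms.L2Operator Topology
open Filter Set Function

namespace Summit.QuantumFields.YangMills.Theorems.FluctuationComparisonRegPrIntLS2BetaChartReadIterFromSupAt

open Literature.MathematicalPhysics.QuantumFieldTheory.Balaban1983to89
open Literature.MathematicalPhysics.QuantumFieldTheory.Balaban1983to89.HaarExponentialChart
open Literature.MathematicalPhysics.QuantumFieldTheory.Balaban1983to89.HaarExponentialChart.IsChartRep
open Literature.MathematicalPhysics.QuantumFieldTheory.Balaban1983to89.BlockAveraging (Small Idx avgFun loopHol blockAvg blockAvg_avg)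
open Literature.MathematicalPhysics.QuantumFieldTheory.Balaban1983to89.ExpMeanLog (expMeanLogSU deltaSU)
open Literature.MathematicalPhysics.QuantumFieldTheory.Balaban1983to89.Node00
open Literature.MathematicalPhysics.QuantumFieldTheory.Balaban1983to89.T3ContinuumYM3Torus
open Literature.MathematicalPhysics.QuantumFieldTheory.Balaban1983to89.T3LevelShift
open Literature.MathematicalPhysics.QuantumFieldTheory.Balaban1983to89.T4AvgSensitivity (iterFrom)
open Summit.QuantumFields.YangMills.BalabanUVNodes.N09ChartReadAveragingSmooth
open Summit.QuantumFields.YangMills.Theorems.FluctuationComparisonRegPrIntLS2BetaChartReadDescentOnto (contDiffAt_chartRead_iter)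
open Summit.QuantumFields.YangMills.Theorems.FluctuationComparisonRegPrIntLS2BetaChartReadIterFromSup
  (smallBelow_shift_of_loopGuard fderiv_chartReadFrom_eq norm_fderiv_chartReadFrom_apply_le_exp)

variable {N : ℕ} [NeZero N] (F : T3Family)

/-- ★ **THE TARGET-INDEXED SEGMENT MAP'S DERIVATIVE**: `fderiv ℝ Ψ^{W}_{k₀→k} 0 = R_σ ∘L fderiv ℝ Ψ^{W}_{k₀,n} 0` with `R_σ Y := Y ∘ σ`, `σ : PBond (F.P K) k ≃ PBond (F.P K) (k₀+n)` the in-tower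
reindexing (`k₀ + n = k`), under ✓p840392's loop guards. [cite: Balaban1987RG1, (0.11) p.253; Balaban1985Averaging, Prop. 4 (127) p.37] -/
theorem fderiv_chartReadFromAt_eq {K k₀ n k : ℕ} (hkn : k₀ + n = k) (hk : k ≤ F.m + K) (W : GaugeField (F.P K) k₀ (SU N)) {α : ℕ → ℝ}
    (hαδ : ∀ i, α i < deltaSU (Fin N))
    (hα : ∀ i, i < n → ∀ (c : PBond (F.P K) (k₀ + i + 1)) (idx : Idx (F.P K)),
      dist1 (loopHol (iterFrom (fun i => blockAvg (P := F.P K) (j := i) (expMeanLogSU (n := Fin N))) k₀ i W) c idx) ≤ α i) :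
    fderiv ℝ (fun (A : PBond (F.P K) k₀ → (specialUnitaryLogChart (Fin N)).lie) (c : PBond (F.P K) k) =>
        (isChartRep_specialUnitaryGroup (n := Fin N)).logChart
          (iterFrom (fun i => blockAvg (P := F.P K) (j := i) (expMeanLogSU (n := Fin N))) k₀ n
              (fun b : PBond (F.P K) k₀ => (isChartRep_specialUnitaryGroup (n := Fin N)).expChart (A b) * W b)
              (bondShift (F.sitesPerDir_eq (m := F.m) (K := K) (j := k) (m' := F.m) (K' := K) (j' := k₀ + n) (by omega)) c) *
            (iterFrom (fun i => blockAvg (P := F.P K) (j := i) (expMeanLogSU (n := Fin N))) k₀ n W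
              (bondShift (F.sitesPerDir_eq (m := F.m) (K := K) (j := k) (m' := F.m) (K' := K) (j' := k₀ + n) (by omega)) c))⁻¹)) 0 =
      (ContinuousLinearMap.pi fun (c : PBond (F.P K) k) =>
          ContinuousLinearMap.proj (R := ℝ) (φ := fun _ : PBond (F.P K) (k₀ + n) => (specialUnitaryLogChart (Fin N)).lie)
            (bondShift (F.sitesPerDir_eq (m := F.m) (K := K) (j := k) (m' := F.m) (K' := K) (j' := k₀ + n) (by omega)) c)).comp
        (fderiv ℝ (fun (A : PBond (F.P K) k₀ → (specialUnitaryLogChart (Fin N)).lie) (c : PBond (F.P K) (k₀ + n)) =>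
          (isChartRep_specialUnitaryGroup (n := Fin N)).logChart
            (iterFrom (fun i => blockAvg (P := F.P K) (j := i) (expMeanLogSU (n := Fin N))) k₀ n
                (fun b : PBond (F.P K) k₀ => (isChartRep_specialUnitaryGroup (n := Fin N)).expChart (A b) * W b) c *
              (iterFrom (fun i => blockAvg (P := F.P K) (j := i) (expMeanLogSU (n := Fin N))) k₀ n W c)⁻¹)) 0) := by
  set Ψ := fun (A : PBond (F.P K) k₀ → (specialUnitaryLogChart (Fin N)).lie) (c : PBond (F.P K) (k₀ + n)) =>
      (isChartRep_specialUnitaryGroup (n := Fin N)).logChart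
        (iterFrom (fun i => blockAvg (P := F.P K) (j := i) (expMeanLogSU (n := Fin N))) k₀ n
            (fun b : PBond (F.P K) k₀ => (isChartRep_specialUnitaryGroup (n := Fin N)).expChart (A b) * W b) c *
          (iterFrom (fun i => blockAvg (P := F.P K) (j := i) (expMeanLogSU (n := Fin N))) k₀ n W c)⁻¹) with hΨ
  set R : (PBond (F.P K) (k₀ + n) → (specialUnitaryLogChart (Fin N)).lie) →L[ℝ] (PBond (F.P K) k → (specialUnitaryLogChart (Fin N)).lie) :=
    ContinuousLinearMap.pi fun (c : PBond (F.P K) k) =>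
      ContinuousLinearMap.proj (R := ℝ) (φ := fun _ : PBond (F.P K) (k₀ + n) => (specialUnitaryLogChart (Fin N)).lie)
        (bondShift (F.sitesPerDir_eq (m := F.m) (K := K) (j := k) (m' := F.m) (K' := K) (j' := k₀ + n) (by omega)) c) with hR
  have hfun : (fun (A : PBond (F.P K) k₀ → (specialUnitaryLogChart (Fin N)).lie) (c : PBond (F.P K) k) =>
        (isChartRep_specialUnitaryGroup (n := Fin N)).logChart
          (iterFrom (fun i => blockAvg (P := F.P K) (j := i) (expMeanLogSU (n := Fin N))) k₀ n
              (fun b : PBond (F.P K) k₀ => (isChartRep_specialUnitaryGroup (n := Fin N)).expChart (A b) * W b)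
              (bondShift (F.sitesPerDir_eq (m := F.m) (K := K) (j := k) (m' := F.m) (K' := K) (j' := k₀ + n) (by omega)) c) *
            (iterFrom (fun i => blockAvg (P := F.P K) (j := i) (expMeanLogSU (n := Fin N))) k₀ n W
              (bondShift (F.sitesPerDir_eq (m := F.m) (K := K) (j := k) (m' := F.m) (K' := K) (j' := k₀ + n) (by omega)) c))⁻¹)) =
      (⇑R ∘ Ψ) := by
    funext A
    funext c
    simp only [Function.comp_apply, hR, hΨ, ContinuousLinearMap.pi_apply, ContinuousLinearMap.proj_apply]
  rw [hfun]
  -- `Ψ` is differentiable at `0`: it is `T_out ∘ Ψ̃ ∘ T_in` (✓p840392 §3) with `Ψ̃` the chart-read on the shorter tower, differentiable under the guards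
  have hD : DifferentiableAt ℝ Ψ 0 := by
    have hsb := smallBelow_shift_of_loopGuard (N := N) F (K := K) (k₀ := k₀) (n := n) (by omega) W hαδ hα
    set Wt := fieldShift (F.sitesPerDir_eq (m := F.m + K - k₀) (K := 0) (j := 0) (m' := F.m) (K' := K) (j' := k₀) (by omega)) W with hWt
    set Ψt := fun (A : PBond (F.PP (F.m + K - k₀) 0) 0 → (specialUnitaryLogChart (Fin N)).lie) (c : PBond (F.PP (F.m + K - k₀) 0) n) =>
        (isChartRep_specialUnitaryGroup (n := Fin N)).logChart
          (Averaging.iter (fun i => blockAvg (P := F.PP (F.m + K - k₀) 0) (j := i) (expMeanLogSU (n := Fin N))) n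
              (fun b => (isChartRep_specialUnitaryGroup (n := Fin N)).expChart (A b) * Wt b) c *
            (Averaging.iter (fun i => blockAvg (P := F.PP (F.m + K - k₀) 0) (j := i) (expMeanLogSU (n := Fin N))) n Wt c)⁻¹) with hΨt_def
    set Tin : (PBond (F.P K) k₀ → (specialUnitaryLogChart (Fin N)).lie) →L[ℝ] (PBond (F.PP (F.m + K - k₀) 0) 0 → (specialUnitaryLogChart (Fin N)).lie) :=
      ContinuousLinearMap.pi fun (ℓ : PBond (F.PP (F.m + K - k₀) 0) 0) =>
        ContinuousLinearMap.proj (R := ℝ) (φ := fun _ : PBond (F.P K) k₀ => (specialUnitaryLogChart (Fin N)).lie)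
          (bondShift (F.sitesPerDir_eq (m := F.m + K - k₀) (K := 0) (j := 0) (m' := F.m) (K' := K) (j' := k₀) (by omega)) ℓ) with hTin
    set Tout : (PBond (F.PP (F.m + K - k₀) 0) n → (specialUnitaryLogChart (Fin N)).lie) →L[ℝ] (PBond (F.P K) (k₀ + n) → (specialUnitaryLogChart (Fin N)).lie) :=
      ContinuousLinearMap.pi fun (c : PBond (F.P K) (k₀ + n)) =>
        ContinuousLinearMap.proj (R := ℝ) (φ := fun _ : PBond (F.PP (F.m + K - k₀) 0) n => (specialUnitaryLogChart (Fin N)).lie)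
          ((bondShift (F.sitesPerDir_eq (m := F.m + K - k₀) (K := 0) (j := n) (m' := F.m) (K' := K) (j' := k₀ + n) (by omega))).symm c) with hTout
    have hfun2 : Ψ = (⇑Tout ∘ (Ψt ∘ ⇑Tin)) := by
      funext A
      funext c
      rw [hΨ]
      simp only [Function.comp_apply, hTout, hTin, hΨt_def, hWt, ContinuousLinearMap.pi_apply, ContinuousLinearMap.proj_apply]
      exact Summit.QuantumFields.YangMills.Theorems.FluctuationComparisonRegPrIntLS2BetaChartReadIterFromSup.chartReadFrom_eq_shift F (by omega) W A c
    rw [hfun2]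
    have hT0 : Tin 0 = 0 := map_zero Tin
    have hΨD : DifferentiableAt ℝ Ψt (Tin 0) := by
      rw [hT0]
      exact (contDiffAt_chartRead_iter (P := F.PP (F.m + K - k₀) 0) (N := N) Wt n hsb).differentiableAt (by simp)
    have h1 : HasFDerivAt (Ψt ∘ ⇑Tin) ((fderiv ℝ Ψt (Tin 0)).comp Tin) 0 :=
      HasFDerivAt.comp (𝕜 := ℝ) (f := ⇑Tin) (f' := Tin) (g := Ψt) (g' := fderiv ℝ Ψt (Tin 0))
        (0 : PBond (F.P K) k₀ → (specialUnitaryLogChart (Fin N)).lie) hΨD.hasFDerivAt Tin.hasFDerivAt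
    have h2 : HasFDerivAt (⇑Tout ∘ (Ψt ∘ ⇑Tin)) (Tout.comp ((fderiv ℝ Ψt (Tin 0)).comp Tin)) 0 :=
      HasFDerivAt.comp (𝕜 := ℝ) (f := Ψt ∘ ⇑Tin) (f' := (fderiv ℝ Ψt (Tin 0)).comp Tin) (g := ⇑Tout) (g' := Tout)
        (0 : PBond (F.P K) k₀ → (specialUnitaryLogChart (Fin N)).lie) Tout.hasFDerivAt h1
    exact h2.differentiableAt
  have h1 : HasFDerivAt (⇑R ∘ Ψ) (R.comp (fderiv ℝ Ψ 0)) 0 :=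
    HasFDerivAt.comp (𝕜 := ℝ) (f := Ψ) (f' := fderiv ℝ Ψ 0) (g := ⇑R) (g' := R)
      (0 : PBond (F.P K) k₀ → (specialUnitaryLogChart (Fin N)).lie) R.hasFDerivAt hD.hasFDerivAt
  exact h1.fderiv

/-- ★★★ **THE SEGMENT SUP ROW, TARGET-INDEXED** (px13 g29's `hseg` shape): for `k₀ + n = k ≤ m + K` and ✓p840392's loop guards,
**`‖↑((fderiv ℝ Ψ^{W}_{k₀→k} 0 X) B)‖ ≤ (1 + 4(d+2))·exp((d+2)(422 + 1616(d+2))·Σ_{i<n} α_i)·L^n·‖X‖`** for every `B : PBond (F.P K) k`. [cite: Balaban1985Averaging, Prop. 4 (127)-(130), (139)-(147) pp.37-40; Balaban1987RG1, (0.11) p.253] -/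
theorem norm_fderiv_chartReadFromAt_apply_le_exp {K k₀ n k : ℕ} (hkn : k₀ + n = k) (hk : k ≤ F.m + K) (W : GaugeField (F.P K) k₀ (SU N))
    (X : PBond (F.P K) k₀ → (specialUnitaryLogChart (Fin N)).lie) {α : ℕ → ℝ}
    (hα0 : ∀ i, 0 ≤ α i) (hα24 : ∀ i, α i ≤ 1 / 24) (hαδ : ∀ i, α i < deltaSU (Fin N))
    (hα : ∀ i, i < n → ∀ (c : PBond (F.P K) (k₀ + i + 1)) (idx : Idx (F.P K)),
      dist1 (loopHol (iterFrom (fun i => blockAvg (P := F.P K) (j := i) (expMeanLogSU (n := Fin N))) k₀ i W) c idx) ≤ α i)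
    (B : PBond (F.P K) k) :
    ‖((fderiv ℝ (fun (A : PBond (F.P K) k₀ → (specialUnitaryLogChart (Fin N)).lie) (c : PBond (F.P K) k) =>
          (isChartRep_specialUnitaryGroup (n := Fin N)).logChart
            (iterFrom (fun i => blockAvg (P := F.P K) (j := i) (expMeanLogSU (n := Fin N))) k₀ n
                (fun b : PBond (F.P K) k₀ => (isChartRep_specialUnitaryGroup (n := Fin N)).expChart (A b) * W b)
                (bondShift (F.sitesPerDir_eq (m := F.m) (K := K) (j := k) (m' := F.m) (K' := K) (j' := k₀ + n) (by omega)) c) *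
              (iterFrom (fun i => blockAvg (P := F.P K) (j := i) (expMeanLogSU (n := Fin N))) k₀ n W
                (bondShift (F.sitesPerDir_eq (m := F.m) (K := K) (j := k) (m' := F.m) (K' := K) (j' := k₀ + n) (by omega)) c))⁻¹)) 0 X B :
          (specialUnitaryLogChart (Fin N)).lie) : Matrix (Fin N) (Fin N) ℂ)‖ ≤
      (1 + 4 * (((F.P K).d + 2 : ℕ) : ℝ)) * Real.exp ((((F.P K).d + 2 : ℕ) : ℝ) * (422 + 1616 * (((F.P K).d + 2 : ℕ) : ℝ)) * ∑ j ∈ Finset.range n, α j) *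
        ((F.P K).L : ℝ) ^ n * ‖X‖ := by
  rw [fderiv_chartReadFromAt_eq F hkn hk W hαδ hα]
  simp only [ContinuousLinearMap.comp_apply, ContinuousLinearMap.pi_apply, ContinuousLinearMap.proj_apply]
  exact norm_fderiv_chartReadFrom_apply_le_exp (N := N) F (by omega) W X hα0 hα24 hαδ hα _

/-- ★★★ **THE SEGMENT SUP ROW, TARGET-INDEXED, IN SUP FORM** (verbatim the `hseg` letter of px13 g29's `…S2BetaSecondOrderTowerSup.norm_sub_segment_le` at `Dseg k₀ k := ↑∘(fderiv ℝ Ψ^{W}_{k₀→k} 0)`):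
for `k₀ + n = k ≤ m + K`, ✓p840392's loop guards and a matrix-norm sup bound `∀ b, ‖↑(X b)‖ ≤ s`,
**`‖↑((fderiv ℝ Ψ^{W}_{k₀→k} 0 X) B)‖ ≤ ((1 + 4(d+2))·exp((d+2)(422 + 1616(d+2))·Σ_{i<n} α_i))·L^{k−k₀}·s`**. [cite: Balaban1985Averaging, Prop. 4 (127)-(130), (139)-(147) pp.37-40; Balaban1987RG1, (0.11) p.253] -/
theorem norm_fderiv_chartReadFromAt_apply_le_of_sup {K k₀ n k : ℕ} (hkn : k₀ + n = k) (hk : k ≤ F.m + K) (W : GaugeField (F.P K) k₀ (SU N))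
    (X : PBond (F.P K) k₀ → (specialUnitaryLogChart (Fin N)).lie) {α : ℕ → ℝ}
    (hα0 : ∀ i, 0 ≤ α i) (hα24 : ∀ i, α i ≤ 1 / 24) (hαδ : ∀ i, α i < deltaSU (Fin N))
    (hα : ∀ i, i < n → ∀ (c : PBond (F.P K) (k₀ + i + 1)) (idx : Idx (F.P K)),
      dist1 (loopHol (iterFrom (fun i => blockAvg (P := F.P K) (j := i) (expMeanLogSU (n := Fin N))) k₀ i W) c idx) ≤ α i)
    (s : ℝ) (hs : ∀ b, ‖((X b : (specialUnitaryLogChart (Fin N)).lie) : Matrix (Fin N) (Fin N) ℂ)‖ ≤ s) (B : PBond (F.P K) k) :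
    ‖((fderiv ℝ (fun (A : PBond (F.P K) k₀ → (specialUnitaryLogChart (Fin N)).lie) (c : PBond (F.P K) k) =>
          (isChartRep_specialUnitaryGroup (n := Fin N)).logChart
            (iterFrom (fun i => blockAvg (P := F.P K) (j := i) (expMeanLogSU (n := Fin N))) k₀ n
                (fun b : PBond (F.P K) k₀ => (isChartRep_specialUnitaryGroup (n := Fin N)).expChart (A b) * W b)
                (bondShift (F.sitesPerDir_eq (m := F.m) (K := K) (j := k) (m' := F.m) (K' := K) (j' := k₀ + n) (by omega)) c) *
              (iterFrom (fun i => blockAvg (P := F.P K) (j := i) (expMeanLogSU (n := Fin N))) k₀ n W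
                (bondShift (F.sitesPerDir_eq (m := F.m) (K := K) (j := k) (m' := F.m) (K' := K) (j' := k₀ + n) (by omega)) c))⁻¹)) 0 X B :
          (specialUnitaryLogChart (Fin N)).lie) : Matrix (Fin N) (Fin N) ℂ)‖ ≤
      (1 + 4 * (((F.P K).d + 2 : ℕ) : ℝ)) * Real.exp ((((F.P K).d + 2 : ℕ) : ℝ) * (422 + 1616 * (((F.P K).d + 2 : ℕ) : ℝ)) * ∑ j ∈ Finset.range n, α j) *
        ((F.P K).L : ℝ) ^ (k - k₀) * s := by
  have hs0 : 0 ≤ s := (norm_nonneg _).trans (hs ⟨default, B.dir⟩)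
  have hXs : ‖X‖ ≤ s := by
    refine (pi_norm_le_iff_of_nonneg hs0).2 fun b => ?_
    rw [← Submodule.norm_coe]
    exact hs b
  have hkk : k - k₀ = n := by omega
  rw [hkk]
  refine (norm_fderiv_chartReadFromAt_apply_le_exp F hkn hk W X hα0 hα24 hαδ hα B).trans ?_
  have hC : 0 ≤ (1 + 4 * (((F.P K).d + 2 : ℕ) : ℝ)) *
      Real.exp ((((F.P K).d + 2 : ℕ) : ℝ) * (422 + 1616 * (((F.P K).d + 2 : ℕ) : ℝ)) * ∑ j ∈ Finset.range n, α j) * ((F.P K).L : ℝ) ^ n :=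
    mul_nonneg (mul_nonneg (by positivity) (Real.exp_pos _).le) (pow_nonneg (Nat.cast_nonneg _) _)
  exact mul_le_mul_of_nonneg_left hXs hC

end Summit.QuantumFields.YangMills.Theorems.FluctuationComparisonRegPrIntLS2BetaChartReadIterFromSupAt

end
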